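import Mathlib.Topology.Algebra.Group.OpenMapping
import Literature.NumberTheory.Automorphic.ParabolicBruhatCellsTopology
import Literature.NumberTheory.Automorphic.GLnGelfandKazhdanInvolution
import Literature.NumberTheory.Automorphic.ReductionTheoryGLnConjugation
import Literature.NumberTheory.Automorphic.ParabolicInduction
import Literature.NumberTheory.Automorphic.WhittakerTwistedJacquet
import HarnessLib

/-!
# Bruhat cells of `GL_n(F)` as homogeneous spaces of `P_c × U_n`: compact support in the cell

Topic `NumberTheory/Automorphic`. Let `F` be a non-archimedean local field, `c` a monotone block
labelling of `Fin n`, `P = P_c`, `U = U_n` and `X_σ = P P_σ U ⊆ GL_n(F)` a `(P, U)`-double coset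
(`parabolicDoubleCoset`). By `ParabolicBruhatCellsTopology`, `X_σ` is locally closed
(`cellLE \ cellLT`, both closed), hence a locally compact Hausdorff — so Baire — space, on which the
`σ`-compact group `P × U` acts continuously and transitively by `(p, u) · x = p x u⁻¹`. The open
mapping theorem for such actions (Mathlib `isOpenMap_smul_of_sigmaCompact`) gives:

* `isOpenMap_parabolicCellAction` — the orbit maps `(p, u) ↦ p x u⁻¹` onto the cell are open;
* `exists_isCompact_subset_parabolic_mul_permGL_mul` — **compact subsets of a cell are compact in
  the `U`-direction**: every compact `C_K ⊆ X_σ` lies in `P P_σ C` for a compact `C ⊆ U`;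
* `exists_isCompact_support_of_eq_zero_on_cellLT` — consequently, if a locally constant function
  `f` on `GL_n(F)` with `P`-invariant support vanishes on the smaller cells `cellLT c σ`, then the
  support of `u ↦ f (P_σ u)` on `U` is **compact modulo the stabiliser** `U ∩ P_σ⁻¹ P P_σ`: there is
  a compact `C ⊆ U` such that `f (P_σ u) ≠ 0` forces `u v⁻¹ ∈ P_σ⁻¹ P P_σ` for some `v ∈ C`. This is
  the finiteness input for the cell-by-cell analysis of `Ind_P^G σ |_U` in the heredity theorem
  for Whittaker functionals (Bernstein–Zelevinsky 1977, §5.14: for an `l`-group countable at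
  infinity acting transitively, the orbit is homeomorphic to `P \ G`, quoting
  Bernstein–Zelevinsky 1976, §1.5; this is what makes the `Q`-orbits on `P \ G` usable in the
  geometric lemma, Thm. 5.2).

Only theorems (and the `def` of the action, with body); no named fact.

## References

* I. N. Bernstein, A. V. Zelevinsky, *Induced representations of reductive `p`-adic groups I*,
  Ann. Sci. ÉNS 10 (1977), §5.14 ("if the group `G` is countable at infinity then `X` is
  homeomorphic to the quotient-space `P \ G`", citing [1] = Bernstein–Zelevinsky 1976, §1.5),
  Thm. 5.2 (the geometric lemma, filtration by `Q`-orbits on `P \ G`) (held, read).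
  [BernsteinZelevinskyASENS1977]
* I. N. Bernstein, A. V. Zelevinsky, *Representations of the group GL(n, F) where F is a
  non-archimedean local field*, Russian Math. Surveys 31:3 (1976), §1.5. [BernsteinZelevinskyRMS1976]
* Mathlib, `isOpenMap_smul_of_sigmaCompact` (open mapping theorem for `σ`-compact groups acting
  transitively on Baire spaces).
-/

open scoped Pointwise
open Topology

namespace Literature.NumberTheory.Automorphic

section LocalField

variable {F : Type*} [Field F] [ValuativeRel F] [TopologicalSpace F] [IsNonarchimedeanLocalField F]
  {n : ℕ} {α : Type*} [LinearOrder α] [Fintype α] (c : Fin n → α)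

/-! ### The action of `P_c × U_n` on a cell -/

/-- The action `(p, u) · x = p x u⁻¹` of `P_c × U_n` on the double coset `P_c P_σ U_n`.
[folklore] -/
@[reducible] def parabolicCellAction (σ : Equiv.Perm (Fin n)) :
    MulAction (↥(standardParabolicGL F c) × ↥(upperUnitriangular (Fin n) F))
      ↥(parabolicDoubleCoset (K := F) c σ) where
  smul h x := ⟨(h.1 : GL (Fin n) F) * x * ((h.2 : GL (Fin n) F))⁻¹,
    mul_mul_mem_parabolicDoubleCoset c x.2 h.1.2 (Subgroup.inv_mem _ h.2.2)⟩
  one_smul x := Subtype.ext (by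
    change ((1 : ↥(standardParabolicGL F c)) : GL (Fin n) F) * x *
      (((1 : ↥(upperUnitriangular (Fin n) F)) : GL (Fin n) F))⁻¹ = x
    simp)
  mul_smul h h' x := Subtype.ext (by
    change ((h.1 * h'.1 : ↥(standardParabolicGL F c)) : GL (Fin n) F) * x *
        (((h.2 * h'.2 : ↥(upperUnitriangular (Fin n) F)) : GL (Fin n) F))⁻¹ =
      (h.1 : GL (Fin n) F) * ((h'.1 : GL (Fin n) F) * x * ((h'.2 : GL (Fin n) F))⁻¹) *
        ((h.2 : GL (Fin n) F))⁻¹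
    simp only [Subgroup.coe_mul, mul_inv_rev, mul_assoc])

attribute [local instance] parabolicCellAction

omit [ValuativeRel F] [TopologicalSpace F] [IsNonarchimedeanLocalField F] [Fintype α] in
/-- The action, on underlying matrices: `(p, u) · x = p x u⁻¹`. [folklore] -/
@[simp] lemma coe_parabolicCellAction_smul (σ : Equiv.Perm (Fin n))
    (h : ↥(standardParabolicGL F c) × ↥(upperUnitriangular (Fin n) F))
    (x : ↥(parabolicDoubleCoset (K := F) c σ)) :
    ((h • x : ↥(parabolicDoubleCoset (K := F) c σ)) : GL (Fin n) F) =
      (h.1 : GL (Fin n) F) * x * ((h.2 : GL (Fin n) F))⁻¹ := rfl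

omit [ValuativeRel F] [TopologicalSpace F] [IsNonarchimedeanLocalField F] [Fintype α] in
/-- The action is transitive (a double coset is one orbit). [folklore] -/
theorem isPretransitive_parabolicCellAction (σ : Equiv.Perm (Fin n)) :
    MulAction.IsPretransitive (↥(standardParabolicGL F c) × ↥(upperUnitriangular (Fin n) F))
      ↥(parabolicDoubleCoset (K := F) c σ) := by
  refine ⟨fun x y => ?_⟩
  obtain ⟨p₁, hp₁, u₁, hu₁, hx⟩ := x.2
  obtain ⟨p₂, hp₂, u₂, hu₂, hy⟩ := y.2
  refine ⟨(⟨p₂ * p₁⁻¹, Subgroup.mul_mem _ hp₂ (Subgroup.inv_mem _ hp₁)⟩,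
    ⟨u₂⁻¹ * u₁, Subgroup.mul_mem _ (Subgroup.inv_mem _ hu₂) hu₁⟩), Subtype.ext ?_⟩
  rw [coe_parabolicCellAction_smul]
  change p₂ * p₁⁻¹ * (x : GL (Fin n) F) * (u₂⁻¹ * u₁)⁻¹ = y
  rw [hx, hy]
  group

omit [Fintype α] in
/-- The action is continuous. [folklore] -/
theorem continuousSMul_parabolicCellAction (σ : Equiv.Perm (Fin n)) :
    ContinuousSMul (↥(standardParabolicGL F c) × ↥(upperUnitriangular (Fin n) F))
      ↥(parabolicDoubleCoset (K := F) c σ) := by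
  refine ⟨?_⟩
  refine Continuous.subtype_mk ?_ _
  exact ((continuous_subtype_val.comp (continuous_fst.comp continuous_fst)).mul
    (continuous_subtype_val.comp continuous_snd)).mul
      ((continuous_subtype_val.comp (continuous_snd.comp continuous_fst)).inv)

/-- A cell is **locally closed** in `GL_n(F)`. [folklore] -/
theorem isLocallyClosed_parabolicDoubleCoset (hc : Monotone c) (σ : Equiv.Perm (Fin n)) :
    IsLocallyClosed (parabolicDoubleCoset (K := F) c σ) := by
  haveI : T2Space F := (GaloisRepresentations.IsNonarchimedeanLocalField.isLocalField F).toT2Space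
  refine ⟨(cellLT (K := F) c σ)ᶜ, cellLE (K := F) c σ, (isClosed_cellLT c hc σ).isOpen_compl,
    isClosed_cellLE c hc σ, ?_⟩
  rw [← cellLE_diff_cellLT (K := F) c hc σ, Set.sdiff_eq_compl_inter]

/-- **The orbit maps of `P_c × U_n` on a cell are open** (open mapping theorem: `P_c × U_n` is
`σ`-compact, the cell is locally compact Hausdorff, hence Baire, and the action is transitive).
(Bernstein–Zelevinsky 1977, §5.14, from Bernstein–Zelevinsky 1976, §1.5: a transitive `l`-space of
an `l`-group countable at infinity is the quotient by a stabiliser.)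
[cite: BernsteinZelevinskyASENS1977, §5.14] -/
theorem isOpenMap_parabolicCellAction (hc : Monotone c) (σ : Equiv.Perm (Fin n))
    (x : ↥(parabolicDoubleCoset (K := F) c σ)) :
    IsOpenMap fun h : ↥(standardParabolicGL F c) × ↥(upperUnitriangular (Fin n) F) => h • x := by
  haveI : T2Space F := (GaloisRepresentations.IsNonarchimedeanLocalField.isLocalField F).toT2Space
  haveI : T2Space (GL (Fin n) F) := t2Space_generalLinearGroup F n
  haveI : LocallyCompactSpace (GL (Fin n) F) := locallyCompactSpace_generalLinearGroup F n
  haveI : SigmaCompactSpace (GL (Fin n) F) := sigmaCompactSpace_generalLinearGroup F n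
  haveI : SigmaCompactSpace ↥(standardParabolicGL F c) :=
    (isClosed_standardParabolicGL F c).sigmaCompactSpace
  haveI : SigmaCompactSpace ↥(upperUnitriangular (Fin n) F) :=
    (isClosed_upperUnitriangular (R := F) (n := n)).sigmaCompactSpace
  haveI : LocallyCompactSpace ↥(parabolicDoubleCoset (K := F) c σ) :=
    (isLocallyClosed_parabolicDoubleCoset c hc σ).locallyCompactSpace
  haveI : T2Space ↥(parabolicDoubleCoset (K := F) c σ) := inferInstance
  haveI : BaireSpace ↥(parabolicDoubleCoset (K := F) c σ) :=
    BaireSpace.of_t2Space_locallyCompactSpace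
  haveI : SigmaCompactSpace (↥(standardParabolicGL F c) × ↥(upperUnitriangular (Fin n) F)) :=
    inferInstance
  haveI : IsTopologicalGroup (↥(standardParabolicGL F c) × ↥(upperUnitriangular (Fin n) F)) :=
    inferInstance
  exact @isOpenMap_smul_of_sigmaCompact _ _ _ _ _ ‹_› (parabolicCellAction (F := F) c σ) ‹_› ‹_› ‹_›
    (continuousSMul_parabolicCellAction (F := F) c σ) (isPretransitive_parabolicCellAction (F := F) c σ) x

/-! ### Compact subsets of a cell are compact in the `U`-direction -/

/-- **Compact subsets of a cell are compact in the `U`-direction**: every compact `C_K ⊆ P_c P_σ U_n`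
lies in `P_c P_σ C` for some compact `C ⊆ U_n`. (Cover `C_K` by the open images `P P_σ u V` of
`P × (u V)` under the orbit maps, `V` a compact open subgroup of `U_n`.) [folklore] -/
theorem exists_isCompact_subset_parabolic_mul_permGL_mul (hc : Monotone c) (σ : Equiv.Perm (Fin n))
    {C_K : Set (GL (Fin n) F)} (hCK : IsCompact C_K) (hsub : C_K ⊆ parabolicDoubleCoset (K := F) c σ) :
    ∃ C : Set ↥(upperUnitriangular (Fin n) F), IsCompact C ∧
      ∀ g ∈ C_K, ∃ p ∈ standardParabolicGL F c, ∃ v ∈ C, g = p * permGL σ * (v : GL (Fin n) F) := by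
  classical
  -- a compact open subgroup `V` of `U_n`
  obtain ⟨V, hVo, hVc, -⟩ := isLimitOfCompactOpen_upperUnitriangular (F := F) (n := n) _
    (Set.finite_singleton (1 : ↥(upperUnitriangular (Fin n) F))).isCompact
  -- the orbit map at `P_σ` is open
  obtain ⟨x₀, hx₀⟩ : ∃ x₀ : ↥(parabolicDoubleCoset (K := F) c σ), (x₀ : GL (Fin n) F) = permGL σ :=
    ⟨⟨permGL σ, permGL_mem_parabolicDoubleCoset c σ⟩, rfl⟩
  obtain ⟨orb, horb_def⟩ : ∃ orb : ↥(standardParabolicGL F c) × ↥(upperUnitriangular (Fin n) F) →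
      ↥(parabolicDoubleCoset (K := F) c σ), orb = fun h => h • x₀ := ⟨_, rfl⟩
  have horb : IsOpenMap orb := horb_def ▸ isOpenMap_parabolicCellAction c hc σ x₀
  have horb_val : ∀ h, ((orb h : ↥(parabolicDoubleCoset (K := F) c σ)) : GL (Fin n) F) =
      (h.1 : GL (Fin n) F) * permGL σ * ((h.2 : GL (Fin n) F))⁻¹ := fun h => by
    rw [horb_def, coe_parabolicCellAction_smul, hx₀]
  -- the open pieces `P P_σ u V = orb (P × {w : u⁻¹ w⁻¹ ∈ V})`
  obtain ⟨S, hS_def⟩ : ∃ S : ↥(upperUnitriangular (Fin n) F) → Set ↥(upperUnitriangular (Fin n) F),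
      S = fun u => (fun w => u⁻¹ * w⁻¹) ⁻¹' (V : Set ↥(upperUnitriangular (Fin n) F)) := ⟨_, rfl⟩
  have hS : ∀ u, IsOpen (S u) := fun u => by
    rw [hS_def]
    exact hVo.preimage ((continuous_const_mul u⁻¹).comp continuous_inv)
  have hS_mem : ∀ u w, w ∈ S u ↔ u⁻¹ * w⁻¹ ∈ V := fun u w => by rw [hS_def]; rfl
  obtain ⟨piece, hpiece_def⟩ : ∃ piece : ↥(upperUnitriangular (Fin n) F) →
      Set ↥(parabolicDoubleCoset (K := F) c σ),
      piece = fun u => orb '' ((Set.univ : Set ↥(standardParabolicGL F c)) ×ˢ S u) := ⟨_, rfl⟩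
  have hopen : ∀ u, IsOpen (piece u) := fun u => by
    rw [hpiece_def]
    exact horb _ (isOpen_univ.prod (hS u))
  have hpiece_mem : ∀ u y, y ∈ piece u ↔ ∃ h ∈ (Set.univ : Set ↥(standardParabolicGL F c)) ×ˢ S u,
      orb h = y := fun u y => by rw [hpiece_def]; rfl
  -- every point `p P_σ u` of the cell lies in its piece
  have hcover : ∀ y : ↥(parabolicDoubleCoset (K := F) c σ), ∃ u, y ∈ piece u := by
    intro y
    obtain ⟨p, hp, u, hu, hy⟩ := y.2
    have hmem : ((⟨p, hp⟩ : ↥(standardParabolicGL F c)), (⟨u, hu⟩ : ↥(upperUnitriangular (Fin n) F))⁻¹) ∈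
        (Set.univ : Set ↥(standardParabolicGL F c)) ×ˢ S ⟨u, hu⟩ := by
      refine ⟨Set.mem_univ _, (hS_mem _ _).2 ?_⟩
      rw [inv_inv, inv_mul_cancel]
      exact V.one_mem
    refine ⟨⟨u, hu⟩, (hpiece_mem _ _).2 ⟨_, hmem, Subtype.ext ?_⟩⟩
    rw [horb_val, hy, Subgroup.coe_inv, inv_inv]
  -- a finite subcover of the compact `C_K`
  have hCK' : IsCompact ((Subtype.val : ↥(parabolicDoubleCoset (K := F) c σ) → GL (Fin n) F) ⁻¹' C_K) := by
    rw [Subtype.isCompact_iff, Subtype.image_preimage_coe, Set.inter_eq_right.2 hsub]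
    exact hCK
  obtain ⟨T, hT⟩ := hCK'.elim_finite_subcover piece hopen fun y _ => Set.mem_iUnion.2 (hcover y)
  have hCc : IsCompact (⋃ u ∈ T, (fun v : ↥(upperUnitriangular (Fin n) F) => u * v) ''
      (V : Set ↥(upperUnitriangular (Fin n) F))) :=
    T.isCompact_biUnion fun u _ => hVc.image (continuous_const_mul u)
  refine ⟨_, hCc, fun g hg => ?_⟩
  have hy : (⟨g, hsub hg⟩ : ↥(parabolicDoubleCoset (K := F) c σ)) ∈ ⋃ u ∈ T, piece u := hT hg
  obtain ⟨u, huT, hyu⟩ : ∃ u ∈ T, (⟨g, hsub hg⟩ : ↥(parabolicDoubleCoset (K := F) c σ)) ∈ piece u := by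
    simpa only [Set.mem_iUnion, exists_prop] using hy
  obtain ⟨h, hh, hhg⟩ := (hpiece_mem _ _).1 hyu
  have hv : u⁻¹ * h.2⁻¹ ∈ V := (hS_mem _ _).1 hh.2
  have hgval : g = (h.1 : GL (Fin n) F) * permGL σ * ((h.2 : GL (Fin n) F))⁻¹ := by
    rw [← horb_val h, hhg]
  refine ⟨h.1, h.1.2, u * (u⁻¹ * h.2⁻¹), Set.mem_biUnion huT ⟨_, hv, rfl⟩, ?_⟩
  rw [hgval, mul_inv_cancel_left, Subgroup.coe_inv]

/-! ### Support of functions vanishing on the smaller cells -/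

/-- **Compact support modulo the stabiliser.** Let `f` be a function on `GL_n(F)` with values in a
type with zero, whose non-vanishing set is closed (e.g. `f` locally constant) and invariant under
left multiplication by `P_c`, and which vanishes on the union `cellLT c σ` of the cells below
`σ`. Then there is a compact `C ⊆ U_n` such that `f (P_σ u) ≠ 0` implies `u = a v` with `v ∈ C`
and `P_σ a P_σ⁻¹ ∈ P_c`; i.e. `u ↦ f (P_σ u)` is supported on `(U_n ∩ P_σ⁻¹ P_c P_σ) · C`.
(Iwasawa decomposition `G = P_c · GL_n(𝒪)`: the support inside the cell is `P_c ·` a compact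
subset of the cell, which is compact in the `U`-direction by the previous theorem.)
[cite: BernsteinZelevinskyASENS1977, §5.14 and Thm. 5.2] -/
theorem exists_isCompact_support_of_eq_zero_on_cellLT (hc : Monotone c) (σ : Equiv.Perm (Fin n))
    {W : Type*} [Zero W] (f : GL (Fin n) F → W)
    (hclosed : IsClosed {g | f g ≠ 0})
    (hP : ∀ p ∈ standardParabolicGL F c, ∀ g, f (p * g) ≠ 0 ↔ f g ≠ 0)
    (hvan : ∀ g ∈ cellLT (K := F) c σ, f g = 0) :
    ∃ C : Set ↥(upperUnitriangular (Fin n) F), IsCompact C ∧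
      ∀ u : ↥(upperUnitriangular (Fin n) F), f (permGL σ * (u : GL (Fin n) F)) ≠ 0 →
        ∃ v ∈ C, (permGL σ * ((u * v⁻¹ : ↥(upperUnitriangular (Fin n) F)) : GL (Fin n) F) *
          (permGL σ)⁻¹ : GL (Fin n) F) ∈ standardParabolicGL F c := by
  haveI : T2Space F := (GaloisRepresentations.IsNonarchimedeanLocalField.isLocalField F).toT2Space
  -- the compact `C_K = GL_n(𝒪) ∩ cellLE σ ∩ {f ≠ 0} ⊆ cell σ`
  set C_K : Set (GL (Fin n) F) := (glInt n F : Set (GL (Fin n) F)) ∩ (cellLE (K := F) c σ ∩ {g | f g ≠ 0})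
    with hCK_def
  have hCK : IsCompact C_K := (isCompact_glInt n F).inter_right ((isClosed_cellLE c hc σ).inter hclosed)
  have hCKsub : C_K ⊆ parabolicDoubleCoset (K := F) c σ := by
    rintro g ⟨-, hgLE, hg0⟩
    rw [cellLE_eq_cellLT_union] at hgLE
    rcases hgLE with h | h
    · exact absurd (hvan g h) hg0
    · exact h
  obtain ⟨C, hC, hCcov⟩ := exists_isCompact_subset_parabolic_mul_permGL_mul c hc σ hCK hCKsub
  refine ⟨C, hC, fun u hu => ?_⟩
  -- Iwasawa: `P_σ u = b k`, and `k ∈ C_K`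
  obtain ⟨b, hb, k, hk, hbk⟩ := exists_borel_mul_glInt (permGL σ * (u : GL (Fin n) F))
  have hbP : b ∈ standardParabolicGL F c := borel_le_standardParabolicGL hc hb
  have hkC : k ∈ C_K := by
    have hk' : k = b⁻¹ * (permGL σ * (u : GL (Fin n) F)) := by rw [hbk]; group
    refine ⟨hk, ?_, ?_⟩
    · rw [hk', cellLE_eq_cellLT_union]
      right
      have := mul_mul_mem_parabolicDoubleCoset (K := F) c (permGL_mem_parabolicDoubleCoset c σ)
        (Subgroup.inv_mem _ hbP) u.2
      simpa [mul_assoc] using this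
    · show f k ≠ 0
      rw [hk']
      exact (hP _ (Subgroup.inv_mem _ hbP) _).2 hu
  obtain ⟨p, hp, v, hv, hkpv⟩ := hCcov k hkC
  refine ⟨v, hv, ?_⟩
  -- `P_σ u = b k = (b p) P_σ v`, so `P_σ (u v⁻¹) P_σ⁻¹ = b p ∈ P_c`
  have : permGL σ * ((u * v⁻¹ : ↥(upperUnitriangular (Fin n) F)) : GL (Fin n) F) * (permGL σ)⁻¹ =
      b * p := by
    rw [Subgroup.coe_mul, Subgroup.coe_inv]
    calc permGL σ * ((u : GL (Fin n) F) * (v : GL (Fin n) F)⁻¹) * (permGL σ)⁻¹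
        = (permGL σ * (u : GL (Fin n) F)) * ((v : GL (Fin n) F)⁻¹ * (permGL σ)⁻¹) := by group
      _ = (b * k) * ((v : GL (Fin n) F)⁻¹ * (permGL σ)⁻¹) := by rw [hbk]
      _ = b * p := by rw [hkpv]; group
  rw [this]
  exact Subgroup.mul_mem _ hbP hp

end LocalField

end Literature.NumberTheory.Automorphic
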